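/-
Copyright (c) 2026 the pub-hodgecm-mathlib formalisation cell (harness21).  Prover seat hodgecm-mathlib-K2E1-p12 (g0), Track B ∕ K2-LIT, h413 = `stmt-HodgeConjecture-24833`,
line `K2_E1_TraceFormulaBeta`, campaign «R8₂-sph EXHAUSTION», f3-sph FILE D (dealer K2E1-plan (g6) deal (103)) ED. 3: the `hradial` PAYER — `β`-weighted integrals of RADIAL functions
on `U(J₂)(𝔸)` are `K_r ∫_0^∞ Ψ(r) r^{−2} dr` (★ (δ)_two ∘ ★ (GR)), generic quasi-split `U(J₂)`.
-/
import Summits.HodgeConjecture.HodgeConjecture.Theorems.K2E1MaassSelbergBracketsTwo              -- ★ p857654∕… (K2E4-p14): brings ★ (δ)_two `exists_integral_weight_smul_eq_mul_setIntegral_ideleClass_two`, `H(b) = ‖d₀ b‖`, `H(gk) = H(g)`, `H(γg) = H(g)`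
import Summits.HodgeConjecture.HodgeConjecture.Theorems.K2E1MaassSelbergSphericalBracketsCMTwo    -- ★ (K2E4-p10∕p11): `integral_maximalCompact_const`, `measureReal_maximalCompact_pos` (`m_K = μ_K(K_U) ∈ (0,∞)`)
import Summits.HodgeConjecture.HodgeConjecture.Theorems.K2E1IdeleClassRadialIntegralCM          -- ★ C p859507 (K2E1-p13): (GR) `∫_𝓕 ‖x‖⁻¹•φ(‖x‖) dν_I = κ ∫_0^∞ φ(r) r^{−2} dr` and its `[0,∞]` twin
import Summits.HodgeConjecture.HodgeConjecture.Theorems.K2E1MellinPaleyWienerHalfLine            -- ★ A p859444 (K2E3-p12): `integrable_ofReal_cpow_mul` (`r^s·Ψ ∈ L¹` for `Ψ ∈ C_c((0,∞))`)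
import HarnessLib

/-!
# f3-sph FILE D ED. 3 — `K2E1RadialWeightIntegralU2`: `∫_{G(𝔸)} β(g)•Ψ(H(g)) dν_G = K_r ∫_0^∞ Ψ(r) r^{−2} dr` for radial `Ψ ∈ C_c((0,∞))` on a quasi-split `U(J₂)`
# (the `hradial` letter of ★ `K2E1PseudoEisensteinInnerProductCMTwo`, letter-free)

Track B ∕ K2-LIT, crux h413 = `stmt-HodgeConjecture-24833`, route of record `HCCMUnconditional`; cell `hodgecm-mathlib`, squad K2, ENGINE E1.  THEOREMS ONLY (no `def`, no `instance`,
no `notation`, no `sorry`; default heartbeats); lane `--supports stmt-HodgeConjecture-24833 --as helper` (count-neutral).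

THE MATHEMATICS ([MoeglinWaldspurger1995, I.1.13 (Iwasawa), II.2.1]; [Garrett2018, §1.11, §2.8]; [CasselsFrohlichANT1967, Ch. XV, Thm 4.3.2] (Tate's `d𝔞 = d𝔟·dt∕t`)).  `G = U(J₂)` quasi-split
over a quadratic `E∕F` (`c² = 1`, `c ≠ 1`), `H` the Borel height, `β` a covering weight of `B(F)♯`.  For a RADIAL test function `Ψ∘H`, `Ψ : ℝ → ℂ` continuous with compact support in
`(0,∞)`: (1) `Ψ∘H` is Borel, left-`N(𝔸)`-invariant (★ `borelHeight_unipotent_mul`) and left-`B(F)`-invariant (★ `borelHeight_arithmeticBorel_mul`); (2) along `T(𝔸)·K_U`, `H(tk) = ‖d₀t‖`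
(★ `borelHeight_mul_of_mem_comap_standardMaximalCompactGL`, ★ `borelHeight_coe_eq_ideleNorm_diagUnit`), so the `K_U`-average of `Ψ∘H` is `m_K·Ψ(‖d₀t‖)`, `m_K = μ_K(K_U) ∈ (0,∞)` (★
`integral_maximalCompact_const`, `measureReal_maximalCompact_pos`), majorised by `‖Ψ(‖d₀ t‖)‖`; (3) the finiteness `∫⁻_𝓕 ‖x‖⁻¹‖Ψ(‖x‖)‖ dν_I = κ·∫⁻_0^∞ r⁻²‖Ψ(r)‖ dr < ∞` (★ C `[0,∞]` twin
`setLIntegral_inv_ideleNorm_mul_comp_eq`, ★ A `integrable_ofReal_cpow_mul`, `κ = idelicCovolume < ∞` ★).  ★ (δ)_two (ii) then gives `∫ β•(Ψ∘H) dν_G = K·∫_𝓕 ‖x‖⁻¹•(m_K Ψ(‖x‖)) dν_I`, and ★ C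
(GR) `setIntegral_inv_ideleNorm_smul_comp_eq` turns the idele-class integral into `κ ∫_0^∞ Ψ(r) r^{−2} dr`.  HENCE (HEAD) **`exists_integral_weight_smul_radial_eq_two`**: ONE constant
`K_r = K·m_K·κ > 0` (independent of `β` and `Ψ`) with `β•(Ψ∘H) ∈ L¹(ν_G)` and `∫ β(g)•Ψ(H g) dν_G = K_r ∫_0^∞ Ψ(r)·r^{−2} dr` — EXACTLY the `hradial` letter of ★ FILE D ED. 1
`integral_weight_smul_radialPairing_eq_mellin_cm_two` ∕ `pseudoEisenstein_inner_product_cm_two_of_letters`, for every quasi-split `U(J₂)` (in particular the CM data `quasiSplit L⁺ L c̄ 2`).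
HONEST LABEL: HC_CM is proved only modulo the 7 printed citations (2 remaining named inputs: hLiu418 = `stmt-HodgeConjecture-24832`, h413 = `stmt-HodgeConjecture-24833`) until rung 0
closes; this file asserts no named fact, closes no socket; count-neutral; letter-free (structural data `ν_G, μ_K, ν_I, hBK, 𝓕` only, as in ★ MS-TWO).

## References
* [MoeglinWaldspurger1995] C. Mœglin, J.-L. Waldspurger, *Spectral decomposition and Eisenstein series* (1995), I.1.13, II.2.1.
* [Garrett2018] P. Garrett, *Modern Analysis of Automorphic Forms by Example* (2018), §1.11, §2.8.
* [CasselsFrohlichANT1967] J. W. S. Cassels, A. Fröhlich (eds.), *Algebraic Number Theory* (1967), Ch. XV (Tate), Thm 4.3.2.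
-/

set_option autoImplicit false
set_option linter.dupNamespace false  -- the mandated namespace repeats the summit's segment (`HodgeConjecture.HodgeConjecture`)

noncomputable section

open MeasureTheory Measure Set Filter Topology NumberField IsDedekindDomain MulAction
open scoped ENNReal NNReal ComplexConjugate
open Literature.MeasureTheory.Group Literature.NumberTheory
open Literature.NumberTheory.Automorphic Literature.NumberTheory.Automorphic.UnitaryGroup AdelicGroupData
open Summit.HodgeConjecture.HodgeConjecture.Cruxes.H413.K2E1BorelParabolicIntegralU2 (borelHeight_coe_eq_ideleNorm_diagUnit)
open Summit.HodgeConjecture.HodgeConjecture.Cruxes.H413.K2E1EisensteinPairingUnfoldedWeightU2 (exists_integral_weight_smul_eq_mul_setIntegral_ideleClass_two)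
open Summit.HodgeConjecture.HodgeConjecture.Cruxes.H413.K2E1MaassSelbergSphericalBracketsCMTwo (integral_maximalCompact_const measureReal_maximalCompact_pos)
open Summit.HodgeConjecture.HodgeConjecture.Cruxes.H413.K2E1IdeleClassRadialIntegralCM (setIntegral_inv_ideleNorm_smul_comp_eq setLIntegral_inv_ideleNorm_mul_comp_eq)
open Summit.HodgeConjecture.HodgeConjecture.Cruxes.H413.K2E1MellinPaleyWienerHalfLine (integrable_ofReal_cpow_mul)

namespace Summit.HodgeConjecture.HodgeConjecture.Cruxes.H413.K2E1RadialWeightIntegralU2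

variable {F E : Type} [Field F] [NumberField F] [Field E] [NumberField E] [Algebra F E] {c : E ≃ₐ[F] E}
variable [MeasurableSpace (quasiSplit F E c 2).Adelic] [BorelSpace (quasiSplit F E c 2).Adelic]
  [MeasurableSpace (AdeleRing (𝓞 E) E)ˣ] [BorelSpace (AdeleRing (𝓞 E) E)ˣ]

/-- The `[0,∞]`-finiteness of the radial majorant: `∫⁻_0^∞ (r⁻¹·r⁻¹)·‖Ψ(r)‖ₑ dr < ∞` for `Ψ` continuous with compact support in `(0,∞)` — it is the `L¹`-norm of `r ↦ r^{−2}·Ψ(r)`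
(★ A `integrable_ofReal_cpow_mul`). [folklore] -/
theorem setLIntegral_inv_mul_inv_mul_enorm_lt_top {Ψ : ℝ → ℂ} (hΨc : Continuous Ψ) (hΨs : HasCompactSupport Ψ) (hΨ0 : tsupport Ψ ⊆ Ioi 0) :
    ∫⁻ r in Ioi (0 : ℝ), ENNReal.ofReal (r⁻¹ * r⁻¹) * ‖Ψ r‖ₑ < ∞ := by
  have h := (integrable_ofReal_cpow_mul hΨc hΨs hΨ0 (-2)).integrableOn (s := Ioi (0 : ℝ))
  have h2 : ∫⁻ r in Ioi (0 : ℝ), ‖(r : ℂ) ^ (-2 : ℂ) * Ψ r‖ₑ < ∞ := hasFiniteIntegral_iff_enorm.1 h.2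
  refine lt_of_le_of_lt (le_of_eq (setLIntegral_congr_fun measurableSet_Ioi fun r hr => ?_)) h2
  have hr : (0 : ℝ) < r := hr
  rw [enorm_mul, ← ofReal_norm ((r : ℂ) ^ (-2 : ℂ)), Complex.norm_cpow_eq_rpow_re_of_pos hr]
  congr 2
  rw [show ((-2 : ℂ)).re = -2 by simp, Real.rpow_neg hr.le, Real.rpow_two, sq, mul_inv]

/-- **THE `hradial` LETTER, LETTER-FREE (`U(J₂)`, `c² = 1`, `c ≠ 1`).**  `ν_G`, `μ_K`, `ν_I` Haar on `G(𝔸)`, `K_U`, `𝕀_E`; Iwasawa `hBK`; `𝓕` an idele class domain.  There is ONE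
`K_r > 0` such that for EVERY covering weight `β` of `B(F)♯` and EVERY `Ψ : ℝ → ℂ` continuous with compact support in `(0,∞)`: `β•(Ψ∘H) ∈ L¹(ν_G)` and
**`∫ (β g)•Ψ(H g) dν_G = K_r · ∫_0^∞ Ψ(r)·r^{−2} dr`** — ★ (δ)_two (ii) at `Ψ∘H` (radial: `K_U`-average `m_K·Ψ(‖d₀t‖)`, majorant `‖Ψ(‖d₀t‖)‖`, finiteness by ★ C's `[0,∞]` twin and
`setLIntegral_inv_mul_inv_mul_enorm_lt_top`), then ★ C (GR); `K_r = K·m_K·κ`. [cite: MoeglinWaldspurger1995, I.1.13, II.2.1] [cite: Garrett2018, §1.11, §2.8] [cite: CasselsFrohlichANT1967, Ch. XV Thm. 4.3.2] -/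
theorem exists_integral_weight_smul_radial_eq_two (hc : c * c = 1) (hc1 : c ≠ 1)
    (νG : Measure (quasiSplit F E c 2).Adelic) [νG.IsHaarMeasure]
    (μK : Measure ((standardMaximalCompactGL 2 E).comap (adelicVal F E c 2 ((StdForm.antidiagonal 2).over E)) : Subgroup (quasiSplit F E c 2).Adelic))
    [μK.IsHaarMeasure]
    (νI : Measure (AdeleRing (𝓞 E) E)ˣ) [νI.IsHaarMeasure]
    (hBK : ∀ g : (quasiSplit F E c 2).Adelic, ∃ b ∈ borelAdelic F E c 2, ∃ k : (quasiSplit F E c 2).Adelic,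
      adelicVal F E c 2 ((StdForm.antidiagonal 2).over E) k ∈ standardMaximalCompactGL 2 E ∧ g = b * k)
    {𝓕 : Set (AdeleRing (𝓞 E) E)ˣ} (h𝓕 : IsIdeleClassDomain E 𝓕) :
    ∃ Kr : ℝ, 0 < Kr ∧
      ∀ {β : (quasiSplit F E c 2).Adelic → ℝ≥0∞}, IsCoveringWeight ((arithmeticBorel F E c 2).map (quasiSplit F E c 2).arithmeticSubgroup.subtype) β →
      ∀ Ψ : ℝ → ℂ, Continuous Ψ → HasCompactSupport Ψ → tsupport Ψ ⊆ Ioi 0 →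
        Integrable (fun g => (β g).toReal • Ψ (borelHeight g : ℝ)) νG ∧
          ∫ g, (β g).toReal • Ψ (borelHeight g : ℝ) ∂νG = (Kr : ℂ) * ∫ r in Ioi (0 : ℝ), Ψ r * (r : ℂ) ^ (-2 : ℂ) := by
  obtain ⟨K, hK0, hKt, -, hδ⟩ := exists_integral_weight_smul_eq_mul_setIntegral_ideleClass_two hc hc1 νG μK νI hBK h𝓕
  have hm : 0 < μK.real Set.univ := measureReal_maximalCompact_pos μK
  have hκ : 0 < (idelicCovolume E νI).toReal := ENNReal.toReal_pos (idelicCovolume_ne_zero νI) (idelicCovolume_ne_top νI)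
  refine ⟨K.toReal * μK.real Set.univ * (idelicCovolume E νI).toReal, mul_pos (mul_pos (ENNReal.toReal_pos hK0 hKt) hm) hκ, ?_⟩
  intro β hβ Ψ hΨc hΨs hΨ0
  have hIm : Measurable fun x : (AdeleRing (𝓞 E) E)ˣ => IdeleClassGroup.ideleNorm E x := (continuous_ideleNorm_holds E).measurable
  -- (1) the radial integrand `Ψ∘H`: Borel, left-`N(𝔸)`- and left-`B(F)`-invariant
  have hΨm : Measurable fun g : (quasiSplit F E c 2).Adelic => Ψ (borelHeight g : ℝ) := hΨc.measurable.comp measurable_borelHeight.coe_nnreal_real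
  have hΨN : ∀ (n : unipotentInBorel F E c 2) (y : (quasiSplit F E c 2).Adelic),
      Ψ (borelHeight (((n : borelAdelic F E c 2) : (quasiSplit F E c 2).Adelic) * y) : ℝ) = Ψ (borelHeight y : ℝ) := fun n y => by
    rw [borelHeight_unipotent_mul ((mem_unipotentInBorel_iff _).1 n.2)]
  have hΨB : ∀ b ∈ arithmeticBorel F E c 2, ∀ y : (quasiSplit F E c 2).Adelic,
      Ψ (borelHeight ((b : (quasiSplit F E c 2).Adelic) * y) : ℝ) = Ψ (borelHeight y : ℝ) := fun b hb y => by
    rw [K2E1TruncatedEisensteinExplicit.borelHeight_arithmeticBorel_mul hb]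
  -- (2) along `T(𝔸)·K_U`: `H(t k) = ‖d₀ t‖`; the `K_U`-average `Φ = m_K·Ψ(‖·‖)` and the majorant `Φm = ‖Ψ(‖·‖)‖ₑ`
  have hHtk : ∀ (t : torusInBorel F E c 2) (k : ((standardMaximalCompactGL 2 E).comap (adelicVal F E c 2 ((StdForm.antidiagonal 2).over E)) :
      Subgroup (quasiSplit F E c 2).Adelic)),
      borelHeight (((t : borelAdelic F E c 2) : (quasiSplit F E c 2).Adelic) * (k : (quasiSplit F E c 2).Adelic)) = IdeleClassGroup.ideleNorm E (diagUnit (t : borelAdelic F E c 2).2 0) := by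
    intro t k
    rw [borelHeight_mul_of_mem_comap_standardMaximalCompactGL k.2, borelHeight_coe_eq_ideleNorm_diagUnit]
  have hΦm : Measurable fun x : (AdeleRing (𝓞 E) E)ˣ => ((μK.real Set.univ : ℝ) : ℂ) * Ψ (IdeleClassGroup.ideleNorm E x : ℝ) :=
    measurable_const.mul (hΨc.measurable.comp hIm.coe_nnreal_real)
  have hΦK : ∀ k ∈ GaloisRepresentations.principalIdeles E, ∀ x : (AdeleRing (𝓞 E) E)ˣ,
      ((μK.real Set.univ : ℝ) : ℂ) * Ψ (IdeleClassGroup.ideleNorm E (k * x) : ℝ) = ((μK.real Set.univ : ℝ) : ℂ) * Ψ (IdeleClassGroup.ideleNorm E x : ℝ) := fun k hk x => by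
    rw [map_mul, ideleNorm_principal hk, one_mul]
  have hAvg : ∀ t : torusInBorel F E c 2,
      ∫ k, Ψ (borelHeight (((t : borelAdelic F E c 2) : (quasiSplit F E c 2).Adelic) * (k : (quasiSplit F E c 2).Adelic)) : ℝ) ∂μK =
        ((μK.real Set.univ : ℝ) : ℂ) * Ψ (IdeleClassGroup.ideleNorm E (diagUnit (t : borelAdelic F E c 2).2 0) : ℝ) := fun t => by
    simp_rw [hHtk t]
    exact integral_maximalCompact_const μK _
  have hΦmm : Measurable fun x : (AdeleRing (𝓞 E) E)ˣ => ‖Ψ (IdeleClassGroup.ideleNorm E x : ℝ)‖ₑ := (hΨc.measurable.comp hIm.coe_nnreal_real).enorm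
  have hΦmK : ∀ k ∈ GaloisRepresentations.principalIdeles E, ∀ x : (AdeleRing (𝓞 E) E)ˣ,
      ‖Ψ (IdeleClassGroup.ideleNorm E (k * x) : ℝ)‖ₑ = ‖Ψ (IdeleClassGroup.ideleNorm E x : ℝ)‖ₑ := fun k hk x => by
    rw [map_mul, ideleNorm_principal hk, one_mul]
  have hMaj : ∀ (t : torusInBorel F E c 2) (k : ((standardMaximalCompactGL 2 E).comap (adelicVal F E c 2 ((StdForm.antidiagonal 2).over E)) :
      Subgroup (quasiSplit F E c 2).Adelic)),
      ‖Ψ (borelHeight (((t : borelAdelic F E c 2) : (quasiSplit F E c 2).Adelic) * (k : (quasiSplit F E c 2).Adelic)) : ℝ)‖ₑ ≤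
        ‖Ψ (IdeleClassGroup.ideleNorm E (diagUnit (t : borelAdelic F E c 2).2 0) : ℝ)‖ₑ := fun t k => by
    rw [hHtk t k]
  -- (3) finiteness on the idele class group: ★ C's `[0,∞]` twin and the radial `L¹` bound
  have hfin : ∫⁻ x in 𝓕, (((IdeleClassGroup.ideleNorm E x)⁻¹ : ℝ≥0) : ℝ≥0∞) * ‖Ψ (IdeleClassGroup.ideleNorm E x : ℝ)‖ₑ ∂νI < ∞ := by
    rw [setLIntegral_inv_ideleNorm_mul_comp_eq νI h𝓕 (Gm := fun r : ℝ => ‖Ψ r‖ₑ) hΨc.measurable.enorm]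
    exact ENNReal.mul_lt_top (idelicCovolume_lt_top νI) (setLIntegral_inv_mul_inv_mul_enorm_lt_top hΨc hΨs hΨ0)
  -- (4) ★ (δ)_two (ii), the constant `m_K` out, ★ C (GR)
  obtain ⟨hI, -, hE⟩ := hδ β hβ _ hΨm hΨN hΨB _ hΦm hΦK hAvg _ hΦmm hΦmK hMaj hfin
  refine ⟨hI, ?_⟩
  have hpull : ∫ x in 𝓕, (IdeleClassGroup.ideleNorm E x : ℝ)⁻¹ • (((μK.real Set.univ : ℝ) : ℂ) * Ψ (IdeleClassGroup.ideleNorm E x : ℝ)) ∂νI =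
      ((μK.real Set.univ : ℝ) : ℂ) * ∫ x in 𝓕, (IdeleClassGroup.ideleNorm E x : ℝ)⁻¹ • Ψ (IdeleClassGroup.ideleNorm E x : ℝ) ∂νI := by
    rw [← integral_const_mul]
    refine integral_congr_ae (Eventually.of_forall fun x => ?_)
    exact (mul_smul_comm _ _ _).symm
  have hGR := setIntegral_inv_ideleNorm_smul_comp_eq νI h𝓕 (φ := Ψ) (hΨc.comp Real.continuous_exp).aestronglyMeasurable
  rw [hE, hpull, hGR, Complex.real_smul]
  push_cast
  ring

end Summit.HodgeConjecture.HodgeConjecture.Cruxes.H413.K2E1RadialWeightIntegralU2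

end
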